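import Literature.NumberTheory.EllipticCurves.IwasawaAlgebra
import Mathlib.Algebra.CharP.Lemmas
import HarnessLib

/-!
# Three elementary facts in the Iwasawa algebra `Λ = ℤ_p⟦X⟧`: `p`-content of a non-zero power
# series, the Weierstrass shape `X^d · unit + p · w` modulo `p`, and LIFTING THE EXPONENT
# `(1 + X)^{p^n} → 1` modulo `(f, p^j)`

Topic `NumberTheory/EllipticCurves` (the tree's `IwasawaAlgebra p = PowerSeries ℤ_[p]`, file
`IwasawaAlgebra.lean`; namespace `Literature.NumberTheory.EllipticCurves.IwasawaAlgebra` as in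
`IwasawaAlgebraProofs.lean`).  THEOREMS ONLY (no definition, no named fact, no `sorry`).  Cell
`bsd-potss` (seat `bsd-potss-rkm` g7): the commutative-algebra input of the Shapiro-free proof of
Kato, Astérisque 295, Thm. 12.4 (2) "`𝐇¹(T)` is a torsion free `Λ`-module" on the pin
`Kato2004.IwasawaH1Data` (file `Kato2004/IwasawaH1LambdaTorsionFreeProofs.lean`), where `1 + X ∈ Λ`
acts on the `n`-th layer `H¹(ℚ_n, T_pW)` as `conj_γ` and `(1 + X)^{p^n}` acts trivially.

* `exists_eq_pow_mul_of_ne_zero` — every `f ≠ 0` is `p^m · f′` with SOME coefficient of `f′` prime to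
  `p` (`m` = least `p`-adic valuation of a non-zero coefficient; `PadicInt.unitCoeff_spec`).
* `exists_eq_X_pow_mul_add_mul` — such an `f′` is `X^d · v + p · w` with `v ∈ Λˣ` (`d` = least index of
  a coefficient prime to `p`; `PowerSeries.isUnit_iff_constantCoeff`) — the hypothesis of the
  Weierstrass preparation theorem (Washington Thm. 7.3), which is all of it that the consumer needs.
* `exists_one_add_X_pow_eq_base` / `_step` / `_mono` / **`exists_one_add_X_pow_eq`** — for such `f`,
  every `j` and every `N` there is `n ≥ N` with `(1 + X)^{p^n} = 1 + a · f + p^j · b`: the image of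
  `1 + X` in the `(p, X)`-adically complete local ring `Λ/(f)` is a principal unit, so its `p^n`-th
  powers converge to `1`.  Base (`p^k ≥ d`): Frobenius `(1 + X)^{p^k} = 1 + X^{p^k} + p·X·r`
  (`exists_add_pow_prime_pow_eq`) and `X^d = (f − p w) v⁻¹`; step: `(1 + t)^p = 1 + t^p + p t r`
  (`exists_add_pow_prime_eq`) with `t = a f + p^j b`, `(a f + p^j b)^p ≡ p^{jp} b^p (mod f)`, `jp ≥ j+1`.
* `exists_geom_sum_eq` — `Σ_{i<N} u^i = N + (u − 1) · r` in any commutative ring (each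
  `u^i ≡ 1 (mod u − 1)`): the norm element `ν_{n,k} = Σ_{i<p^k} ((1+X)^{p^n})^i` is `≡ p^k (mod ω_n)`.

## References

* [Washington1997] L. C. Washington, *Introduction to Cyclotomic Fields*, 2nd ed. (1997), §7.1
  Prop. 7.2, Thm. 7.3 (pp. 115–116); §13.2–§13.3 (`ω_n`, `ν_{n,m}`, Lemma 13.15).
* [Lang1990] S. Lang, *Cyclotomic Fields I and II* (1990), Ch. 5 §1–§2 (Weierstrass preparation,
  distinguished polynomials).
* Mathlib: `Mathlib.Algebra.CharP.Lemmas` (`exists_add_pow_prime_pow_eq`, `exists_add_pow_prime_eq`),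
  `Mathlib.NumberTheory.Padics.PadicIntegers` (`PadicInt.unitCoeff_spec`, `PadicInt.irreducible_p`),
  `Mathlib.Algebra.Ring.GeomSum` (`sub_one_dvd_pow_sub_one`).
-/

noncomputable section

namespace Literature.NumberTheory.EllipticCurves.IwasawaAlgebra

variable (p : ℕ) [hp : Fact p.Prime]

/-- **`p`-content of a non-zero power series**: every `f ≠ 0` in `ℤ_p⟦X⟧` is `p^m · f′` with some
coefficient of `f′` prime to `p` (`m` = the least `p`-adic valuation of a non-zero coefficient).
[cite: Washington1997, §7.1 (proof of Thm. 7.3, p. 115)] -/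
theorem exists_eq_pow_mul_of_ne_zero {f : PowerSeries ℤ_[p]} (hf : f ≠ 0) :
    ∃ (m : ℕ) (f' : PowerSeries ℤ_[p]), f = (p : PowerSeries ℤ_[p]) ^ m * f' ∧
      ∃ i, ¬ (p : ℤ_[p]) ∣ PowerSeries.coeff i f' := by
  classical
  have hex : ∃ m i, PowerSeries.coeff i f ≠ 0 ∧ (PowerSeries.coeff i f).valuation = m := by
    obtain ⟨i, hi⟩ : ∃ i, PowerSeries.coeff i f ≠ 0 := by
      by_contra h
      exact hf (PowerSeries.ext fun i => by rw [not_not.mp (not_exists.mp h i), map_zero])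
    exact ⟨_, i, hi, rfl⟩
  obtain ⟨i₀, hi₀, hval⟩ := Nat.find_spec hex
  set m := Nat.find hex with hm
  have hmin : ∀ i, PowerSeries.coeff i f ≠ 0 → m ≤ (PowerSeries.coeff i f).valuation :=
    fun i hi => Nat.find_min' hex ⟨i, hi, rfl⟩
  -- `p^m` divides every coefficient
  have hdvd : ∀ i, ∃ g : ℤ_[p], PowerSeries.coeff i f = (p : ℤ_[p]) ^ m * g := by
    intro i
    by_cases hi : PowerSeries.coeff i f = 0
    · exact ⟨0, by rw [hi, mul_zero]⟩
    · refine ⟨(PadicInt.unitCoeff hi : ℤ_[p]) * (p : ℤ_[p]) ^ ((PowerSeries.coeff i f).valuation - m), ?_⟩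
      rw [mul_left_comm, ← pow_add, Nat.add_sub_cancel' (hmin i hi)]
      exact PadicInt.unitCoeff_spec hi
  choose g hg using hdvd
  have hp0 : (p : ℤ_[p]) ≠ 0 := by exact_mod_cast hp.out.ne_zero
  refine ⟨m, PowerSeries.mk g, ?_, i₀, ?_⟩
  · ext i
    rw [← map_natCast (PowerSeries.C (R := ℤ_[p])) p, ← map_pow, PowerSeries.coeff_C_mul,
      PowerSeries.coeff_mk]
    exact hg i
  · rw [PowerSeries.coeff_mk]
    intro hpi
    have h1 : PowerSeries.coeff i₀ f = (PadicInt.unitCoeff hi₀ : ℤ_[p]) * (p : ℤ_[p]) ^ m := by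
      have h := PadicInt.unitCoeff_spec hi₀
      rwa [hval] at h
    have h2 : g i₀ = (PadicInt.unitCoeff hi₀ : ℤ_[p]) := by
      have h3 : (p : ℤ_[p]) ^ m * g i₀ = (p : ℤ_[p]) ^ m * (PadicInt.unitCoeff hi₀ : ℤ_[p]) :=
        (hg i₀).symm.trans (h1.trans (mul_comm _ _))
      exact mul_left_cancel₀ (pow_ne_zero _ hp0) h3
    rw [h2] at hpi
    exact (PadicInt.irreducible_p (p := p)).not_isUnit (isUnit_of_dvd_unit hpi (Units.isUnit _))

/-- **Weierstrass shape modulo `p`**: a power series with SOME coefficient prime to `p` is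
`X^d · v + p · w` with `v` a unit of `ℤ_p⟦X⟧` (`d` = the least index of a coefficient prime to `p`,
`v` = the tail from `d` on, whose constant term is a `p`-adic unit). This is the input
"`f ≡ X^d · unit (mod p)`" of the Weierstrass preparation theorem, which is all we use of it.
[cite: Washington1997, Prop. 7.2 and Thm. 7.3 (pp. 115–116)] -/
theorem exists_eq_X_pow_mul_add_mul {f : PowerSeries ℤ_[p]}
    (hf : ∃ i, ¬ (p : ℤ_[p]) ∣ PowerSeries.coeff i f) :
    ∃ (d : ℕ) (v w : PowerSeries ℤ_[p]), IsUnit v ∧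
      f = PowerSeries.X ^ d * v + (p : PowerSeries ℤ_[p]) * w := by
  classical
  set d := Nat.find hf with hd_def
  have hd : ¬ (p : ℤ_[p]) ∣ PowerSeries.coeff d f := Nat.find_spec hf
  have hlt : ∀ i, i < d → (p : ℤ_[p]) ∣ PowerSeries.coeff i f := fun i hi => by
    have h := Nat.find_min hf (hd_def ▸ hi)
    rwa [not_not] at h
  have hlow : ∀ i, ∃ c : ℤ_[p], i < d → PowerSeries.coeff i f = (p : ℤ_[p]) * c := by
    intro i
    by_cases hi : i < d
    · obtain ⟨c, hc⟩ := hlt i hi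
      exact ⟨c, fun _ => hc⟩
    · exact ⟨0, fun h => absurd h hi⟩
  choose c hc using hlow
  -- the coefficient in degree `d` is a unit of `ℤ_p`
  have hne : PowerSeries.coeff d f ≠ 0 := fun h => hd (h ▸ dvd_zero _)
  have hv0 : (PowerSeries.coeff d f).valuation = 0 := by
    by_contra hv
    apply hd
    rw [PadicInt.unitCoeff_spec hne]
    exact Dvd.dvd.mul_left (dvd_pow_self _ hv) _
  have hunit : IsUnit (PowerSeries.coeff d f) := by
    rw [PadicInt.unitCoeff_spec hne, hv0, pow_zero, mul_one]
    exact Units.isUnit _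
  refine ⟨d, PowerSeries.mk fun j => PowerSeries.coeff (d + j) f,
    PowerSeries.mk fun i => if i < d then c i else 0, ?_, ?_⟩
  · rw [PowerSeries.isUnit_iff_constantCoeff, ← PowerSeries.coeff_zero_eq_constantCoeff_apply,
      PowerSeries.coeff_mk, add_zero]
    exact hunit
  · ext n
    rw [map_add, PowerSeries.coeff_X_pow_mul', ← map_natCast (PowerSeries.C (R := ℤ_[p])) p,
      PowerSeries.coeff_C_mul, PowerSeries.coeff_mk, PowerSeries.coeff_mk]
    by_cases hn : d ≤ n
    · rw [if_pos hn, if_neg (not_lt.mpr hn), mul_zero, add_zero, Nat.add_sub_cancel' hn]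
    · rw [if_neg hn, if_pos (not_le.mp hn), zero_add]
      exact hc n (not_le.mp hn)

/-- **Lifting the exponent, base case**: if `f = X^d · v + p · w` with `v` a unit and `d ≤ p^k`,
then `(1 + X)^{p^k} ≡ 1 (mod (f, p))`: explicitly `(1 + X)^{p^k} = 1 + a · f + p · b`
(Frobenius: `(1 + X)^{p^k} ≡ 1 + X^{p^k} (mod p)`, and `X^d ≡ 0 (mod (f, p))`).
[cite: Washington1997, §7.1 (p. 115)] -/
theorem exists_one_add_X_pow_eq_base {f v w : PowerSeries ℤ_[p]} {d : ℕ} (hv : IsUnit v)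
    (hf : f = PowerSeries.X ^ d * v + (p : PowerSeries ℤ_[p]) * w) {k : ℕ} (hk : d ≤ p ^ k) :
    ∃ a b : PowerSeries ℤ_[p],
      (1 + PowerSeries.X) ^ p ^ k = 1 + a * f + (p : PowerSeries ℤ_[p]) ^ 1 * b := by
  obtain ⟨r, hr⟩ := exists_add_pow_prime_pow_eq hp.out (1 : PowerSeries ℤ_[p]) PowerSeries.X k
  obtain ⟨u, rfl⟩ := hv
  have hX : PowerSeries.X ^ d = (f - (p : PowerSeries ℤ_[p]) * w) * (↑u⁻¹ : PowerSeries ℤ_[p]) := by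
    rw [hf, add_sub_cancel_right, Units.mul_inv_cancel_right]
  refine ⟨PowerSeries.X ^ (p ^ k - d) * (↑u⁻¹ : PowerSeries ℤ_[p]),
    PowerSeries.X * r - PowerSeries.X ^ (p ^ k - d) * w * (↑u⁻¹ : PowerSeries ℤ_[p]), ?_⟩
  have hsplit : (PowerSeries.X : PowerSeries ℤ_[p]) ^ p ^ k =
      PowerSeries.X ^ (p ^ k - d) * PowerSeries.X ^ d := by
    rw [← pow_add, Nat.sub_add_cancel hk]
  rw [hr, one_pow, hsplit, hX, pow_one]
  ring

/-- **Lifting the exponent, inductive step**: `(1 + X)^{p^n} ≡ 1 (mod (f, p^j))` with `j ≥ 1`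
implies `(1 + X)^{p^{n+1}} ≡ 1 (mod (f, p^{j+1}))` (`(1 + t)^p = 1 + t^p + p·t·r` and
`t = a f + p^j b`, `(a f + p^j b)^p ≡ p^{jp} b^p (mod f)`, `jp ≥ j + 1`).
[cite: Washington1997, §7.1 (p. 115)] -/
theorem exists_one_add_X_pow_eq_step {f : PowerSeries ℤ_[p]} {n j : ℕ} (hj : 1 ≤ j)
    (h : ∃ a b : PowerSeries ℤ_[p],
      (1 + PowerSeries.X) ^ p ^ n = 1 + a * f + (p : PowerSeries ℤ_[p]) ^ j * b) :
    ∃ a b : PowerSeries ℤ_[p],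
      (1 + PowerSeries.X) ^ p ^ (n + 1) = 1 + a * f + (p : PowerSeries ℤ_[p]) ^ (j + 1) * b := by
  obtain ⟨a, b, hab⟩ := h
  set α : PowerSeries ℤ_[p] := a * f with hα
  set β : PowerSeries ℤ_[p] := (p : PowerSeries ℤ_[p]) ^ j * b with hβ
  -- `(1 + t)^p = 1 + t^p + p t r`
  obtain ⟨r, hr⟩ := exists_add_pow_prime_eq hp.out (1 : PowerSeries ℤ_[p]) (α + β)
  -- `(α + β)^p = β^p + α q`
  obtain ⟨q, hq⟩ : ∃ q, (α + β) ^ p - β ^ p = ((α + β) - β) * q := sub_dvd_pow_sub_pow (α + β) β p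
  rw [add_sub_cancel_right] at hq
  -- `β^p = p^{j+1} · (p^{jp-(j+1)} b^p)`
  have hjp : j + 1 ≤ j * p := by
    have h2 : 2 ≤ p := hp.out.two_le
    nlinarith
  have hβp : β ^ p = (p : PowerSeries ℤ_[p]) ^ (j + 1) *
      ((p : PowerSeries ℤ_[p]) ^ (j * p - (j + 1)) * b ^ p) := by
    rw [hβ, mul_pow, ← pow_mul, ← mul_assoc, ← pow_add, Nat.add_sub_cancel' hjp]
  refine ⟨a * q + (p : PowerSeries ℤ_[p]) * a * r,
    (p : PowerSeries ℤ_[p]) ^ (j * p - (j + 1)) * b ^ p + b * r, ?_⟩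
  have h1 : (1 + PowerSeries.X) ^ p ^ n = 1 + (α + β) := by rw [hab, hα, hβ, add_assoc]
  calc (1 + PowerSeries.X) ^ p ^ (n + 1)
      = ((1 + PowerSeries.X) ^ p ^ n) ^ p := by rw [pow_succ, pow_mul]
    _ = 1 + ((α + β) ^ p - β ^ p) + β ^ p + p * 1 * (α + β) * r := by rw [h1, hr, one_pow]; ring
    _ = 1 + α * q + β ^ p + p * 1 * (α + β) * r := by rw [hq]
    _ = 1 + (a * q + (p : PowerSeries ℤ_[p]) * a * r) * f +
        (p : PowerSeries ℤ_[p]) ^ (j + 1) *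
          ((p : PowerSeries ℤ_[p]) ^ (j * p - (j + 1)) * b ^ p + b * r) := by
      rw [hβp, hα, hβ]
      ring

/-- Weakening the modulus: `(mod (f, p^j))` implies `(mod (f, p^{j'}))` for `j' ≤ j`.
[cite: Washington1997, §7.1 (p. 115)] -/
theorem exists_one_add_X_pow_eq_mono {f : PowerSeries ℤ_[p]} {n j j' : ℕ} (hj : j' ≤ j)
    (h : ∃ a b : PowerSeries ℤ_[p],
      (1 + PowerSeries.X) ^ p ^ n = 1 + a * f + (p : PowerSeries ℤ_[p]) ^ j * b) :
    ∃ a b : PowerSeries ℤ_[p],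
      (1 + PowerSeries.X) ^ p ^ n = 1 + a * f + (p : PowerSeries ℤ_[p]) ^ j' * b := by
  obtain ⟨a, b, hab⟩ := h
  refine ⟨a, (p : PowerSeries ℤ_[p]) ^ (j - j') * b, ?_⟩
  rw [hab, ← mul_assoc, ← pow_add, Nat.add_sub_cancel' hj]

/-- **Lifting the exponent**: if `f = X^d · v + p · w` with `v` a unit, then for every `j` and
every `N` there is `n ≥ N` with `(1 + X)^{p^n} ≡ 1 (mod (f, p^j))`, i.e.
`(1 + X)^{p^n} = 1 + a · f + p^j · b` — the image of `1 + X` in the `(p, X)`-adically complete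
local ring `ℤ_p⟦X⟧/(f)` is a principal unit, so its `p^n`-th powers tend to `1`.
[cite: Washington1997, §7.1 (p. 115) and §13.2] -/
theorem exists_one_add_X_pow_eq {f v w : PowerSeries ℤ_[p]} {d : ℕ} (hv : IsUnit v)
    (hf : f = PowerSeries.X ^ d * v + (p : PowerSeries ℤ_[p]) * w) (j N : ℕ) :
    ∃ n, N ≤ n ∧ ∃ a b : PowerSeries ℤ_[p],
      (1 + PowerSeries.X) ^ p ^ n = 1 + a * f + (p : PowerSeries ℤ_[p]) ^ j * b := by
  -- base at `k₀ = d` (`d ≤ p^d`), then `R(d + i, i + 1)` for all `i`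
  have hbase := exists_one_add_X_pow_eq_base p hv hf (Nat.lt_pow_self hp.out.one_lt (n := d)).le
  have hiter : ∀ i : ℕ, ∃ a b : PowerSeries ℤ_[p],
      (1 + PowerSeries.X) ^ p ^ (d + i) = 1 + a * f + (p : PowerSeries ℤ_[p]) ^ (i + 1) * b := by
    intro i
    induction i with
    | zero => simpa using hbase
    | succ i ih =>
      have := exists_one_add_X_pow_eq_step p (f := f) (n := d + i) (j := i + 1) le_add_self ih
      simpa [Nat.add_assoc] using this
  refine ⟨d + (j + N), by omega, ?_⟩
  exact exists_one_add_X_pow_eq_mono p (by omega) (hiter (j + N))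

/-- **The norm element is `≡ p^k` modulo `ω_n`**: for any `u` in a commutative ring and any `N`,
`Σ_{i<N} u^i = N + (u − 1) · r` (each `u^i ≡ 1 (mod u − 1)`); applied to `u = (1 + X)^{p^n}`,
`N = p^k`: `ν_{n,k} = Σ_{i<p^k} (1+X)^{p^n i} ≡ p^k (mod ω_n)`, `ω_n = (1 + X)^{p^n} − 1`.
[cite: Washington1997, §13.3 (Lemma 13.15)] -/
theorem exists_geom_sum_eq {R : Type*} [CommRing R] (u : R) (N : ℕ) :
    ∃ r : R, (Finset.range N).sum (fun i => u ^ i) = (N : R) + (u - 1) * r := by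
  induction N with
  | zero => exact ⟨0, by simp⟩
  | succ N ih =>
    obtain ⟨r, hr⟩ := ih
    obtain ⟨q, hq⟩ := sub_one_dvd_pow_sub_one u N
    refine ⟨r + q, ?_⟩
    rw [Finset.sum_range_succ, hr, Nat.cast_succ]
    linear_combination hq

end Literature.NumberTheory.EllipticCurves.IwasawaAlgebra

end
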